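import Summits.QuantumFields.YangMills.Theorems.F4SubCurvatureDoorLaplaceFourierRegistered
import Summits.QuantumFields.YangMills.Theorems.F4SubCurvatureDoorRationalToGeneralLaplacianMultiplier
import Literature.Analysis.Complex.HolomorphicParametricIntegral
import Mathlib
import HarnessLib

/-!
# S1 programme (⟨stmt-QuantumFields-23125⟩) — rung R-S1∂ `DirectionalExtension` BY NAME

Crux `F4SubCurvatureDoor.RationalToGeneral` ⟨stmt-QuantumFields-23125⟩, owner file `Cruxes/RationalToGeneral/Lines/forward_cone_rungs.lean`
(ns `…ForwardConeRungs`).  This file restates `IsD4Isometry` and R-S1∂ `DirectionalExtension` CHARACTER-IDENTICALLY and proves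
`directionalExtension_holds : DirectionalExtension`: in the frame of any short root `u = R e₀` (`R` a `D₄`-isometry) a class kernel extends
holomorphically in the complex `u`-direction over the half-space `x·u > 0`, with the axis bound.

PROOF.  `D₄`-invariance of the class gives `K(x + a u) = K(R⁻¹x + a e₀)`; `R⁻¹x + a e₀ = timeSpace (⟪x,u⟫ + a) z⃗'` with `z⃗'` the spatial part of
`R⁻¹x` (`⟪R⁻¹x, e₀⟫ = ⟪x, u⟫` by isometry), so by `IsLF` it is `∫ e^{-(⟪x,u⟫ + a)E} cos⟪q⃗, z⃗'⟫ dμ` for `a > -⟪x,u⟫`; the function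
`F(w) = ∫ e^{-(⟪x,u⟫ + w)E} cos⟪q⃗, z⃗'⟫ dμ` is holomorphic on `Re w > -⟪x,u⟫` (the tree's dominated holomorphic parameter integral
`Literature.Analysis.Complex.differentiableOn_integral_of_dominated`, local bound `e^{-R'E}`), and `‖F(w)‖ ≤ ∫ e^{-(⟪x,u⟫ + Re w)E} dμ = K(timeSpace
(⟪x,u⟫ + Re w) 0)` (`IsLF` at `z⃗ = 0`).

HONEST LABEL: one rung (S–M) of the S1 programme; R-S1a/b/c/d, S1, ⟨23125⟩, ⟨23035⟩, R2d and the Yang–Mills mass gap remain OPEN (R-S1c is the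
separate file `…ConePinning`); no summit is proved by a line.
-/

noncomputable section

open MeasureTheory Filter Topology Set Metric
open scoped BigOperators

namespace Summit.QuantumFields.YangMills.Theorems.F4SubCurvatureDoorDirectionalExtensionRegistered

open Literature.MathematicalPhysics.QuantumLattice (siteToE)
open Summit.QuantumFields.YangMills.Theorems.F4SubCurvatureDoorLaplaceFourierRegistered (E4 E3 InClass timeSpace IsLF)
open Summit.QuantumFields.YangMills.Theorems.F4SubCurvatureDoorLaplacianMultiplierRegistered (timeSpace_apply_zero timeSpace_apply_succ)

/-- `R` preserves the even lattice `D₄` (verbatim from `Lines/fibre_dichotomy.lean`). -/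
def IsD4Isometry (R : E4 ≃ₗᵢ[ℝ] E4) : Prop :=
  ∀ z : Fin 4 → ℤ, Even (∑ i, z i) → ∃ w : Fin 4 → ℤ, Even (∑ i, w i) ∧ R (siteToE z) = siteToE w

/-- R-S1∂ «DIRECTIONAL EXTENSION» (S–M): in the frame of any short root `u = R e₀`, the class kernel extends holomorphically in the complex
`u`-direction over the half-space `x·u > 0`, bounded by the axis function.  (The Laplace–Fourier integral read in the `u`-frame: `R⁻¹ u = e₀` has no
spatial part, so only the time argument becomes complex.) -/
def DirectionalExtension : Prop :=
  ∀ (K : E4 → ℝ) (μ : Measure (ℝ × E3)), InClass K → IsLF K μ →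
    ∀ R : E4 ≃ₗᵢ[ℝ] E4, IsD4Isometry R → ∀ x : E4, 0 < inner ℝ x (R (timeSpace 1 0)) →
      ∃ F : ℂ → ℂ, DifferentiableOn ℂ F {w : ℂ | -(inner ℝ x (R (timeSpace 1 0))) < w.re} ∧
        (∀ a : ℝ, -(inner ℝ x (R (timeSpace 1 0))) < a → F (a : ℂ) = ((K (x + a • R (timeSpace 1 0)) : ℝ) : ℂ)) ∧
        (∀ w : ℂ, -(inner ℝ x (R (timeSpace 1 0))) < w.re →
            ‖F w‖ ≤ K (timeSpace (inner ℝ x (R (timeSpace 1 0)) + w.re) 0))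

/-! ## Coordinates -/

/-- The time unit vector `e₀ = timeSpace 1 0` is `EuclideanSpace.single 0 1`. -/
theorem timeSpace_one_zero : timeSpace 1 (0 : E3) = EuclideanSpace.single (0 : Fin 4) (1 : ℝ) := by
  ext k
  cases k using Fin.cases with
  | zero => simp [timeSpace_apply_zero]
  | succ j => simp [timeSpace_apply_succ, Fin.succ_ne_zero]

/-- `⟪y, e₀⟫ = y 0`. -/
theorem inner_timeSpace_one_zero (y : E4) : inner ℝ y (timeSpace 1 (0 : E3)) = y 0 := by
  rw [timeSpace_one_zero, EuclideanSpace.inner_single_right]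
  simp

/-- Decomposition along the time axis: `y + a e₀ = timeSpace (y 0 + a) (spatial part of y)`. -/
theorem add_smul_timeSpace_eq (y : E4) (a : ℝ) :
    y + a • timeSpace 1 (0 : E3) = timeSpace (y 0 + a) ((WithLp.equiv 2 (Fin 3 → ℝ)).symm fun j => y j.succ) := by
  rw [timeSpace_one_zero]
  ext k
  cases k using Fin.cases with
  | zero => simp [timeSpace_apply_zero]
  | succ j => simp [timeSpace_apply_succ, Fin.succ_ne_zero]

/-! ## The rung -/

/-- **RUNG R-S1∂ (by name): `DirectionalExtension`.** -/
theorem directionalExtension_holds : DirectionalExtension := by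
  intro K μ hK hLF R hR x hx
  obtain ⟨h0, hint, hrepr⟩ := hLF
  have hinv : ∀ y : E4, K (R y) = K y := hK.2.2.2.2.2 R hR
  -- the frame data
  set u : E4 := R (timeSpace 1 0) with hu
  set s₀ : ℝ := inner ℝ x u with hs₀
  set y : E4 := R.symm x with hy
  set z' : E3 := (WithLp.equiv 2 (Fin 3 → ℝ)).symm fun j => y j.succ with hz'
  have hy0 : y 0 = s₀ := by
    rw [hs₀, ← inner_timeSpace_one_zero, hy, hu, ← LinearIsometryEquiv.inner_map_map R (R.symm x) (timeSpace 1 0),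
      LinearIsometryEquiv.apply_symm_apply]
  -- `K(x + a u) = K(timeSpace (s₀ + a) z')`
  have hline : ∀ a : ℝ, K (x + a • u) = K (timeSpace (s₀ + a) z') := by
    intro a
    have e1 : x + a • u = R (y + a • timeSpace 1 0) := by
      rw [map_add, LinearIsometryEquiv.map_smul, hy, LinearIsometryEquiv.apply_symm_apply]
    rw [e1, hinv, add_smul_timeSpace_eq, hy0]
  -- a.e. nonnegativity of the energy
  have hae : ∀ᵐ p ∂μ, 0 ≤ p.1 := by
    have h1 : ∀ᵐ p ∂μ, p ∉ Set.Iio (0 : ℝ) ×ˢ (Set.univ : Set E3) := measure_eq_zero_iff_ae_notMem.1 h0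
    filter_upwards [h1] with p hp
    simp only [Set.mem_prod, Set.mem_Iio, Set.mem_univ, and_true, not_lt] at hp
    exact hp
  -- the integrand and the candidate
  set Fi : ℂ → ℝ × E3 → ℂ := fun w p =>
    Complex.exp (-(((s₀ : ℂ) + w) * (p.1 : ℂ))) * ((Real.cos (inner ℝ p.2 z') : ℝ) : ℂ) with hFi
  have hFnorm : ∀ w p, ‖Fi w p‖ ≤ Real.exp (-((s₀ + w.re) * p.1)) := by
    intro w p
    simp only [hFi, norm_mul, Complex.norm_exp, Complex.norm_real, Real.norm_eq_abs]
    have hre : (-(((s₀ : ℂ) + w) * (p.1 : ℂ))).re = -((s₀ + w.re) * p.1) := by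
      simp [Complex.mul_re]
    rw [hre]
    exact mul_le_of_le_one_right (Real.exp_pos _).le (Real.abs_cos_le_one _)
  have hFcont : ∀ w, Continuous (Fi w) := fun w => by
    simp only [hFi]
    fun_prop
  have hFdiff : ∀ p, Differentiable ℂ fun w => Fi w p := fun p => by
    simp only [hFi]
    fun_prop
  have hopen : IsOpen {w : ℂ | -s₀ < w.re} := isOpen_lt continuous_const Complex.continuous_re
  refine ⟨fun w => ∫ p, Fi w p ∂μ, ?_, ?_, ?_⟩
  · -- holomorphy on the half-plane
    refine Literature.Analysis.Complex.differentiableOn_integral_of_dominated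
      (fun w _ => (hFcont w).aestronglyMeasurable)
      (Eventually.of_forall fun p => (hFdiff p).differentiableOn) ?_
    intro w₀ hw₀
    have hw₀' : -s₀ < w₀.re := hw₀
    set R' : ℝ := (s₀ + w₀.re) / 2 with hR'
    have hR'pos : 0 < R' := by rw [hR']; linarith
    refine ⟨R', hR'pos, ?_, fun p => Real.exp (-(R' * p.1)), hint R' hR'pos, ?_⟩
    · intro w hw
      rw [mem_ball] at hw
      show -s₀ < w.re
      have h1 : |w.re - w₀.re| < R' := by
        have := Complex.abs_re_le_norm (w - w₀)
        rw [Complex.sub_re] at this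
        rw [dist_eq_norm] at hw
        linarith
      rw [abs_lt] at h1
      linarith
    · filter_upwards [hae] with p hp w hw
      rw [mem_ball, dist_eq_norm] at hw
      refine (hFnorm w p).trans (Real.exp_le_exp.2 ?_)
      have h1 : |w.re - w₀.re| < R' := by
        have := Complex.abs_re_le_norm (w - w₀)
        rw [Complex.sub_re] at this
        linarith
      rw [abs_lt] at h1
      have h2 : R' ≤ s₀ + w.re := by linarith
      nlinarith
  · -- real points
    intro a ha
    have hpos : 0 < s₀ + a := by linarith
    rw [hline a, hrepr (s₀ + a) z' hpos, ← integral_complex_ofReal]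
    refine integral_congr_ae (ae_of_all _ fun p => ?_)
    simp only [hFi]
    push_cast
    ring_nf
  · -- the axis bound
    intro w hw
    have hpos : 0 < s₀ + w.re := by linarith
    have hr := hrepr (s₀ + w.re) 0 hpos
    simp only [inner_zero_right, Real.cos_zero, mul_one] at hr
    rw [hr]
    refine norm_integral_le_of_norm_le (hint (s₀ + w.re) hpos) (ae_of_all _ fun p => hFnorm w p)

end Summit.QuantumFields.YangMills.Theorems.F4SubCurvatureDoorDirectionalExtensionRegistered

end
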